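import Mathlib
import Summits.ResolutionOfSingularities.ResolutionOfSingularities.Theorems.HomologicalConductorPersistenceCyclicTransferStable
import HarnessLib

/-!
# Crux `Persistence` (stmt-16484) / rung S-2 `PersistenceSurface` (stmt-19970) — the ISOTYPIC AVERAGING LEMMA
# for a FINITE GROUP of `U`-algebra automorphisms (one-step T-V for every UAC discriminant group `D(Γ)`)
# (chain W4.4b, seat res-L1-w44b-stub-4 gen 5; T-V package part 8)

[OURS · L1 w44b · rung S-2] Nothing here is a statement of the manuscript under review (Hironaka 2017);
AI-written, weaker than expert review.  Part 8 of the cyclic-transfer / Veronese-lemma package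
(`…PersistenceCyclicTransfer{Family,General,Stable,Coinduced,Syzygy,Pairing,Retract}`, p532144 … p537074):
the master lemma `PersistenceCyclicTransferGeneral.exists_comp_eq_smul_id_fixed_of_isotypic` (p532938) with the
cyclic automorphism `σ`, `σ ^ d = 1`, replaced by a finite group `G` acting through `σ : G →* (V →ₐ[U] V)` whose
fixed ring is (the injective image of) `U`, and the powers `ω ^ j` of one root of unity replaced by a family of
`U`-valued multiplicative characters `χ x : G → U` (`x : X`, any finite index type) satisfying the (second)
ORTHOGONALITY RELATION `∑_x χ x g = 0` for `g ≠ 1`, with `|X|, |G| ∈ Uˣ`.  The statement needs neither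
commutativity of `G` nor multiplicativity in `x`; for `G` abelian and `X = Ĝ ≅ G` realised by a bicharacter it is
the honest character theory of `G` (part 9, `…CyclicTransferAbelianBicharacter`).

WHY (S2-BRIEF v1.7 ff., CHAIN v13.6–v13.9, §V13.17 R22): the universal abelian covers `V → V^H = T₁` of the
quasi-homogeneous S-a arrivals have `H = D(Γ)`, cyclic for E12/E13/Z12/E14/W12 but NOT for Z11 (ℤ/3 × ℤ/6),
Z13 (ℤ/3 × ℤ/24), W13 (ℤ/2 × ℤ/4 × ℤ/12), where the chain used TWO-STEP transfers along `1 ⊂ C ⊂ H` (hypotheses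
needed again on `V^C`).  This lemma transfers in ONE step for any finite `H`, with the isotypic product ideal
`𝔞_ψ^H := ⋂_{x ∈ Ĥ} V_[x] · V_[(x ψ)⁻¹]` (sums of products, as in part 2); the one-step ideal can only be larger.

SETTING. `U → V` commutative rings, `σ : G →* (V →ₐ[U] V)` with `(∀ g, σ g v = v) → v ∈ image U`,
`algebraMap U V` injective; `χ : X → G → U` with `χ x 1 = 1`, `χ x (g h) = χ x g · χ x h`, `∑_x χ x g = 0` for
`g ≠ 1`; `τ g` a `σ g`-semilinear action of `G` on a `V`-module `M` (`τ (g h) = τ g ∘ τ h`, `τ 1 = id`),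
`j : N ↪ M` the `U`-module of `G`-invariants.

RESULTS.
* `exists_restrict_of_equivariant_group`, `exists_comp_eq_smul_id_fixed_of_equivariant_family_group` — part 1's
  restriction of `G`-EQUIVARIANT free-factorisation families to the invariants (`(Vˢ)^G = Uˢ`).
* `exists_comp_eq_smul_id_fixed_of_isotypic_group` — THE LEMMA: a free `V`-factorisation `π ∘ ι = c • id_M`
  with `σ g c = ψ(g) c` and `a ∈ V` such that for every `x : X`, `a = ∑_k b_k b'_k` with `σ g b_k = χ x g · b_k`,
  `σ g b'_k = χ y g · b'_k` for some `y : X` with `χ y · χ x · ψ = 1` pointwise, give a free `U`-factorisation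
  of `u • id_N` whenever `algebraMap u = a c`.
* `StablyAnnihilates.fixed_of_isotypic_group` — the CA-layer form.

PROOF: part 2's averaging with `G` in place of `ℤ/d` — conjugates `ι⁽ᵍ⁾ = σ_g^F ι τ_{g⁻¹}`, `π⁽ᵍ⁾ = τ_g π σ_{g⁻¹}^F`,
character components `F_x = ∑_g χ x g • ι⁽ᵍ⁾`, `P_y = ∑_g χ y g • π⁽ᵍ⁾` (equivariant after the twists by `b_k`, `b'_k`),
orthogonality `ψ g · ∑_x χ y_x g · χ x g' = |X| [g = g']`, total `|X|·|G|·a c • id`; restrict to `N`, divide by `|X| |G|`.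

References: Iyengar–Takahashi, IMRN 2016, arXiv:1404.1476, Remark 2.13 (stable annihilation)
[`IyengarTakahashi2014`]; the isotypic split is the character projector of a finite group (folklore).
DIMENSION CAVEAT as in part 2: the lemma is dimension-free; its MCM input is 2-dimensional.
-/


-- single-problem summit: the doubled namespace component `ResolutionOfSingularities` is forced
set_option linter.dupNamespace false

noncomputable section

open CategoryTheory Literature.RingTheory.CohomologyAnnihilator
open Summit.ResolutionOfSingularities.ResolutionOfSingularities.Theorems.NoZeno.SandwichCluster
open Summit.ResolutionOfSingularities.ResolutionOfSingularities.Theorems.HomologicalConductor.PersistenceSurfaceHullCover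
open Summit.ResolutionOfSingularities.ResolutionOfSingularities.Theorems.HomologicalConductor.PersistenceCyclicTransfer
open Summit.ResolutionOfSingularities.ResolutionOfSingularities.Theorems.HomologicalConductor.PersistenceCyclicTransferFamily

universe u

namespace Summit.ResolutionOfSingularities.ResolutionOfSingularities.Theorems.HomologicalConductor.PersistenceCyclicTransferAbelian

variable {U V : Type u} [CommRing U] [CommRing V] [Algebra U V]
variable {M : Type u} [AddCommGroup M] [Module V M] [Module U M] [IsScalarTower U V M]
variable {N : Type u} [AddCommGroup N] [Module U N]
variable {G : Type*} [Group G]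

/-! ## Restriction of `G`-equivariant pairs to the invariants -/

/-- **Restriction of ONE `G`-equivariant pair**: `V`-linear `A : M → Vˢ`, `B : Vˢ → M` with
`A (τ g m) = σ g ∘ A m` and `τ g (B x) = B (σ g ∘ x)` for all `g` restrict to `U`-linear `f : N → Uˢ`, `b : Uˢ → N`
with `j ∘ b ∘ f = B ∘ A ∘ j` (`(Vˢ)^G = Uˢ`). [folklore] -/
theorem exists_restrict_of_equivariant_group (σ : G →* (V →ₐ[U] V))
    (hfix : ∀ v : V, (∀ g, σ g v = v) → ∃ u : U, algebraMap U V u = v)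
    (hinj : Function.Injective (algebraMap U V)) (τ : G → (M →+ M)) (j : N →ₗ[U] M)
    (hjinj : Function.Injective j) (hjτ : ∀ g n, τ g (j n) = j n) (hjsurj : ∀ m, (∀ g, τ g m = m) → ∃ n, j n = m)
    {s : ℕ} (A : M →ₗ[V] (Fin s → V)) (B : (Fin s → V) →ₗ[V] M) (hA : ∀ g m i, A (τ g m) i = σ g (A m i))
    (hB : ∀ g x, τ g (B x) = B (fun i => σ g (x i))) :
    ∃ (f : N →ₗ[U] (Fin s → U)) (b : (Fin s → U) →ₗ[U] N), ∀ n, j (b (f n)) = B (A (j n)) := by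
  classical
  choose φ hφ using hfix
  choose ρ hρ using hjsurj
  have hBfix : ∀ (x : Fin s → U) g, τ g (B (fun i => algebraMap U V (x i))) = B (fun i => algebraMap U V (x i)) := by
    intro x g
    rw [hB]
    simp only [AlgHom.commutes]
  have hι : ∀ (x y : Fin s → U), (fun i => algebraMap U V ((x + y) i)) =
      (fun i => algebraMap U V (x i)) + (fun i => algebraMap U V (y i)) := fun x y => by
    funext i; simp
  have hιs : ∀ (c : U) (x : Fin s → U), (fun i => algebraMap U V ((c • x) i)) =
      algebraMap U V c • (fun i => algebraMap U V (x i)) := fun c x => by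
    funext i; simp
  have hAfix : ∀ n i g, σ g (A (j n) i) = A (j n) i := fun n i g => by rw [← hA, hjτ]
  let f : N →ₗ[U] (Fin s → U) :=
    { toFun := fun n i => φ (A (j n) i) (hAfix n i)
      map_add' := fun n n' => by
        funext i
        apply hinj
        simp only [Pi.add_apply, map_add, hφ]
      map_smul' := fun c n => by
        funext i
        apply hinj
        simp only [Pi.smul_apply, smul_eq_mul, map_mul, RingHom.id_apply, hφ, LinearMap.map_smul_of_tower]
        exact Algebra.smul_def c _ }
  let b : (Fin s → U) →ₗ[U] N :=
    { toFun := fun x => ρ (B (fun i => algebraMap U V (x i))) (hBfix x)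
      map_add' := fun x y => by
        apply hjinj
        rw [map_add, hρ, hρ, hρ, hι, map_add]
      map_smul' := fun c x => by
        apply hjinj
        rw [LinearMap.map_smul_of_tower, hρ, hρ, RingHom.id_apply, hιs, map_smul, algebraMap_smul] }
  refine ⟨f, b, fun n => ?_⟩
  have hf : (fun i => algebraMap U V (f n i)) = A (j n) := by funext i; exact hφ _ _
  change j (ρ _ _) = _
  rw [hρ, hf]

/-- **Core restriction lemma, finite `G`-equivariant family**: pairs `(P_k, Q_k)` (any finite index type) with
`∑_k Q_k (P_k m) = w • m` and `algebraMap u = w` give a free `U`-factorisation of `u • id_N` on the invariants.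
[folklore] -/
theorem exists_comp_eq_smul_id_fixed_of_equivariant_family_group (σ : G →* (V →ₐ[U] V))
    (hfix : ∀ v : V, (∀ g, σ g v = v) → ∃ u : U, algebraMap U V u = v)
    (hinj : Function.Injective (algebraMap U V)) (τ : G → (M →+ M)) (j : N →ₗ[U] M)
    (hjinj : Function.Injective j) (hjτ : ∀ g n, τ g (j n) = j n) (hjsurj : ∀ m, (∀ g, τ g m = m) → ∃ n, j n = m)
    {ι : Type*} [Fintype ι] {s : ℕ} (P : ι → (M →ₗ[V] (Fin s → V))) (Q : ι → ((Fin s → V) →ₗ[V] M))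
    (hP : ∀ k g m i, P k (τ g m) i = σ g (P k m i)) (hQ : ∀ k g x, τ g (Q k x) = Q k (fun i => σ g (x i)))
    {w : V} (hsum : ∀ m, ∑ k, Q k (P k m) = w • m) (u : U) (hu : algebraMap U V u = w) :
    ∃ (t : ℕ) (f' : N →ₗ[U] (Fin t → U)) (g' : (Fin t → U) →ₗ[U] N), g' ∘ₗ f' = u • LinearMap.id := by
  classical
  choose p q hpq using fun k =>
    exists_restrict_of_equivariant_group σ hfix hinj τ j hjinj hjτ hjsurj (P k) (Q k) (hP k) (hQ k)
  have hsumU : ∑ k, q k ∘ₗ p k = u • LinearMap.id := by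
    apply LinearMap.ext
    intro x
    apply hjinj
    simp only [LinearMap.coe_sum, Finset.sum_apply, LinearMap.comp_apply, map_sum, hpq, hsum,
      LinearMap.smul_apply, LinearMap.id_apply, LinearMap.map_smul_of_tower, ← hu, algebraMap_smul]
  let n := Fintype.card ι
  obtain ⟨t, a, b, hab⟩ := exists_comp_eq_sum_comp n (fun k => p ((Fintype.equivFin ι).symm k))
    (fun k => q ((Fintype.equivFin ι).symm k))
  refine ⟨t, a, b, hab.trans ?_⟩
  rw [← hsumU]
  exact Equiv.sum_comp (Fintype.equivFin ι).symm (fun k => q k ∘ₗ p k)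

/-! ## The isotypic averaging lemma for a finite group -/

/-- **Isotypic averaging lemma, finite-group form** (one-step T-V for any finite group `G` of `U`-algebra
automorphisms of `V` with fixed ring `U`; for `G` abelian and `χ` its character table this is the honest
statement «`ca`-input of character `ψ` times the isotypic product ideal `𝔞_ψ^G` lands in the invariants' stable
annihilator»).  Data: characters `χ x : G → U` (`x : X`) multiplicative with `χ x 1 = 1` and orthogonality
`∑_x χ x g = 0` (`g ≠ 1`), `|X|, |G| ∈ Uˣ`; `c` with `σ g c = ψ(g) c`; `a` such that for every `x`,
`a = ∑_k b_k b'_k` with `σ g b_k = χ x g · b_k`, `σ g b'_k = χ y g · b'_k` for some `y : X` with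
`χ y g · χ x g · ψ g = 1`; a free `V`-factorisation `π ∘ ι = c • id_M`.  Then `u • id_N` factors through a
finite free `U`-module whenever `algebraMap U V u = a * c`. [folklore] -/
theorem exists_comp_eq_smul_id_fixed_of_isotypic_group [Fintype G] (σ : G →* (V →ₐ[U] V))
    (hfix : ∀ v : V, (∀ g, σ g v = v) → ∃ u : U, algebraMap U V u = v)
    (hinj : Function.Injective (algebraMap U V)) {X : Type*} [Fintype X] (χ : X → G → U)
    (hχone : ∀ x, χ x 1 = 1) (hχmul : ∀ x g h, χ x (g * h) = χ x g * χ x h)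
    (horth : ∀ g : G, g ≠ 1 → ∑ x, χ x g = 0) (hXU : IsUnit ((Fintype.card X : ℕ) : U))
    (hGU : IsUnit ((Fintype.card G : ℕ) : U)) (τ : G → (M →+ M))
    (hτ : ∀ g (v : V) (m : M), τ g (v • m) = σ g v • τ g m) (hτmul : ∀ g h m, τ (g * h) m = τ g (τ h m))
    (hτone : ∀ m, τ 1 m = m) (j : N →ₗ[U] M) (hjinj : Function.Injective j) (hjτ : ∀ g n, τ g (j n) = j n)
    (hjsurj : ∀ m, (∀ g, τ g m = m) → ∃ n, j n = m) {c : V} (ψ : G → U)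
    (hc : ∀ g, σ g c = algebraMap U V (ψ g) * c) {a : V}
    (ha : ∀ x : X, ∃ (n : ℕ) (b b' : Fin n → V) (y : X), (∀ k g, σ g (b k) = algebraMap U V (χ x g) * b k) ∧
      (∀ k g, σ g (b' k) = algebraMap U V (χ y g) * b' k) ∧ (∀ g, χ y g * χ x g * ψ g = 1) ∧
      ∑ k, b k * b' k = a)
    {s : ℕ} (ι : M →ₗ[V] (Fin s → V)) (π : (Fin s → V) →ₗ[V] M) (hπι : π ∘ₗ ι = c • LinearMap.id) (u : U)
    (hu : algebraMap U V u = a * c) :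
    ∃ (t : ℕ) (f' : N →ₗ[U] (Fin t → U)) (g' : (Fin t → U) →ₗ[U] N), g' ∘ₗ f' = u • LinearMap.id := by
  classical
  -- the characters in `V`
  set η : X → G → V := fun x g => algebraMap U V (χ x g) with hηdef
  have hηmul : ∀ x g h, η x (g * h) = η x g * η x h := fun x g h => by simp only [hηdef, hχmul, map_mul]
  have hηone : ∀ x, η x 1 = 1 := fun x => by simp only [hηdef, hχone, map_one]
  have hσU : ∀ g (u₀ : U), σ g (algebraMap U V u₀) = algebraMap U V u₀ := fun g u₀ => AlgHom.commutes (σ g) u₀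
  set θ : G → V := fun g => algebraMap U V (ψ g) with hθdef
  have hc' : ∀ g, σ g c = θ g * c := hc
  have hπι' : ∀ m, π (ι m) = c • m := fun m => by simpa using LinearMap.congr_fun hπι m
  -- inverses
  have hσinv : ∀ g v, σ g⁻¹ (σ g v) = v := fun g v => by
    rw [← AlgHom.mul_apply, ← map_mul, inv_mul_cancel, map_one, AlgHom.one_apply]
  have hσinv' : ∀ g v, σ g (σ g⁻¹ v) = v := fun g v => by
    rw [← AlgHom.mul_apply, ← map_mul, mul_inv_cancel, map_one, AlgHom.one_apply]
  have hτinv : ∀ g m, τ g⁻¹ (τ g m) = m := fun g m => by rw [← hτmul, inv_mul_cancel, hτone]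
  have hτinv' : ∀ g m, τ g (τ g⁻¹ m) = m := fun g m => by rw [← hτmul, mul_inv_cancel, hτone]
  have hτU : ∀ g (u₀ : U) (m : M), τ g (algebraMap U V u₀ • m) = algebraMap U V u₀ • τ g m := fun g u₀ m => by
    rw [hτ, hσU]
  -- coordinatewise action of `G` on the free module
  let sF : G → (Fin s → V) → (Fin s → V) := fun g x i => σ g (x i)
  have sF_apply : ∀ g x i, sF g x i = σ g (x i) := fun _ _ _ => rfl
  have sF_eq : ∀ g x, sF g x = fun i => σ g (x i) := fun _ _ => rfl
  have sF_add : ∀ g x y, sF g (x + y) = sF g x + sF g y := fun g x y => by funext i; simp [sF]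
  have sF_smul : ∀ g (v : V) x, sF g (v • x) = σ g v • sF g x := fun g v x => by funext i; simp [sF]
  have sF_smulU : ∀ g (u₀ : U) x, sF g (algebraMap U V u₀ • x) = algebraMap U V u₀ • sF g x := fun g u₀ x => by
    rw [sF_smul, hσU]
  have sF_mul : ∀ g h x, sF (g * h) x = sF g (sF h x) := fun g h x => by
    funext i; simp only [sF, map_mul, AlgHom.mul_apply]
  have sF_inv : ∀ g x, sF g⁻¹ (sF g x) = x := fun g x => by funext i; simp only [sF, hσinv]
  have sF_inv' : ∀ g x, sF g (sF g⁻¹ x) = x := fun g x => by funext i; simp only [sF, hσinv']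
  have sF_sum : ∀ g (x : G → Fin s → V), sF g (∑ h, x h) = ∑ h, sF g (x h) := fun g x => by
    funext k
    simp only [sF, Finset.sum_apply, map_sum]
  -- the conjugates `ι⁽ᵍ⁾ = σ_g^F ∘ ι ∘ τ_{g⁻¹}`, `π⁽ᵍ⁾ = τ_g ∘ π ∘ σ_{g⁻¹}^F`
  let fC : G → (M →ₗ[V] (Fin s → V)) := fun g =>
    { toFun := fun m => sF g (ι (τ g⁻¹ m))
      map_add' := fun m m' => by rw [map_add, map_add, sF_add]
      map_smul' := fun v m => by rw [hτ, map_smul, sF_smul, hσinv', RingHom.id_apply] }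
  let gC : G → ((Fin s → V) →ₗ[V] M) := fun g =>
    { toFun := fun x => τ g (π (sF g⁻¹ x))
      map_add' := fun x y => by rw [sF_add, map_add, map_add]
      map_smul' := fun v x => by rw [sF_smul, map_smul, hτ, hσinv', RingHom.id_apply] }
  have fC_apply : ∀ g m, fC g m = sF g (ι (τ g⁻¹ m)) := fun _ _ => rfl
  have gC_apply : ∀ g x, gC g x = τ g (π (sF g⁻¹ x)) := fun _ _ => rfl
  -- (R1) `ι⁽ʰᵍ⁾ τ_h = σ_h^F ι⁽ᵍ⁾`
  have hR1 : ∀ g h m, fC (h * g) (τ h m) = sF h (fC g m) := by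
    intro g h m
    rw [fC_apply, fC_apply, mul_inv_rev, hτmul, hτinv, sF_mul]
  -- (R2) `τ_h π⁽ᵍ⁾ = π⁽ʰᵍ⁾ σ_h^F`
  have hR2 : ∀ g h x, τ h (gC g x) = gC (h * g) (sF h x) := by
    intro g h x
    rw [gC_apply, gC_apply, mul_inv_rev, sF_mul, sF_inv, hτmul]
  -- (R3) `π⁽ᵍ⁾ ι⁽ᵍ⁾ = σ_g(c) • id`
  have hR3 : ∀ g m, gC g (fC g m) = (θ g * c) • m := by
    intro g m
    rw [gC_apply, fC_apply, sF_inv, hπι', hτ, hc', hτinv']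
  -- the character components
  let F : X → (M →ₗ[V] (Fin s → V)) := fun x => ∑ g, (η x g) • fC g
  let P : X → ((Fin s → V) →ₗ[V] M) := fun y => ∑ g, (η y g) • gC g
  have F_apply : ∀ x m, F x m = ∑ g, η x g • fC g m := fun x m => by
    show (∑ g, (η x g) • fC g) m = _
    rw [LinearMap.sum_apply]
    rfl
  have P_apply : ∀ y x', P y x' = ∑ g, η y g • gC g x' := fun y x' => by
    show (∑ g, (η y g) • gC g) x' = _
    rw [LinearMap.sum_apply]
    rfl
  -- (R5) `F_x τ_h = χ x h • σ_h^F F_x`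
  have hR5 : ∀ x h m, F x (τ h m) = η x h • sF h (F x m) := by
    intro x h m
    rw [F_apply, F_apply, sF_sum, Finset.smul_sum]
    rw [← Equiv.sum_comp (Equiv.mulLeft h) (fun g => η x g • fC g (τ h m))]
    refine Finset.sum_congr rfl fun g _ => ?_
    rw [Equiv.coe_mulLeft, hηmul, hR1 g h m, sF_smulU, smul_smul]
  -- (R6) `χ y h • τ_h P_y = P_y σ_h^F`
  have hR6 : ∀ y h x', η y h • τ h (P y x') = P y (sF h x') := by
    intro y h x'
    rw [P_apply, P_apply, map_sum, Finset.smul_sum]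
    rw [← Equiv.sum_comp (Equiv.mulLeft h) (fun g => η y g • gC g (sF h x'))]
    refine Finset.sum_congr rfl fun g _ => ?_
    rw [Equiv.coe_mulLeft, hηmul, ← hR2 g h x', hτU, smul_smul]
  -- the isotypic decompositions of `a`
  choose nn b b' y hb hb' hyrel hab using ha
  -- the equivariant pairs `(b_{x,k} F_x, b'_{x,k} P_{y_x})`
  let ιX := Σ x : X, Fin (nn x)
  let Pf : ιX → (M →ₗ[V] (Fin s → V)) := fun q => b q.1 q.2 • F q.1
  let Qf : ιX → ((Fin s → V) →ₗ[V] M) := fun q => b' q.1 q.2 • P (y q.1)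
  have hPf : ∀ q g m i, Pf q (τ g m) i = σ g (Pf q m i) := by
    intro q g m i
    simp only [Pf, LinearMap.smul_apply, Pi.smul_apply, smul_eq_mul, map_mul]
    rw [hR5, hb q.1 q.2, Pi.smul_apply, smul_eq_mul, sF_apply, hηdef]
    ring
  have hQf : ∀ q g x', τ g (Qf q x') = Qf q (fun i => σ g (x' i)) := by
    intro q g x'
    simp only [Qf, LinearMap.smul_apply]
    have hη : algebraMap U V (χ (y q.1) g) = η (y q.1) g := rfl
    rw [hτ, hb' q.1 q.2, mul_comm, mul_smul, hη, hR6, sF_eq]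
  -- (R9) orthogonality: `ψ(g) · ∑_x χ y_x g · χ x g' = |X| [g = g']`
  have hinvχ : ∀ x g, θ g * η (y x) g = η x g⁻¹ := by
    intro x g
    have h1 : η x g⁻¹ * η x g = 1 := by rw [← hηmul, inv_mul_cancel, hηone]
    have h2 : θ g * η (y x) g * η x g = 1 := by
      have := congrArg (algebraMap U V) (hyrel x g)
      simp only [map_mul, map_one] at this
      rw [hθdef, hηdef]
      simp only
      linear_combination this
    calc θ g * η (y x) g = θ g * η (y x) g * (η x g⁻¹ * η x g) := by rw [h1, mul_one]
      _ = η x g⁻¹ * (θ g * η (y x) g * η x g) := by ring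
      _ = η x g⁻¹ := by rw [h2, mul_one]
  have hcoef : ∀ g g' : G, θ g * ∑ x, η (y x) g * η x g' =
      if g = g' then ((Fintype.card X : ℕ) : V) else 0 := by
    intro g g'
    have hterm : ∀ x, θ g * (η (y x) g * η x g') = η x (g⁻¹ * g') := fun x => by
      rw [← mul_assoc, hinvχ, hηmul]
    rw [Finset.mul_sum, Finset.sum_congr rfl fun x _ => hterm x]
    have hsumη : ∑ x, η x (g⁻¹ * g') = algebraMap U V (∑ x, χ x (g⁻¹ * g')) := by
      simp only [hηdef, map_sum]
    rw [hsumη]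
    by_cases h : g = g'
    · subst h
      simp only [inv_mul_cancel, hχone, Finset.sum_const, Finset.card_univ, nsmul_eq_mul, mul_one,
        map_natCast, if_true]
    · have hne : g⁻¹ * g' ≠ 1 := fun h1 => h (inv_mul_eq_one.mp h1)
      rw [horth _ hne, map_zero, if_neg h]
  have hPF : ∀ y₀ x₀ m, P y₀ (F x₀ m) = ∑ g, ∑ g', (η y₀ g * η x₀ g') • gC g (fC g' m) := by
    intro y₀ x₀ m
    rw [P_apply]
    refine Finset.sum_congr rfl fun g _ => ?_
    rw [F_apply, map_sum, Finset.smul_sum]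
    refine Finset.sum_congr rfl fun g' _ => ?_
    rw [map_smul, smul_smul]
  have hS : ∀ m, ∑ x, P (y x) (F x m) =
      (((Fintype.card G : ℕ) : V) * ((((Fintype.card X : ℕ) : V)) * c)) • m := by
    intro m
    -- the coefficient matrix
    set C : G → G → V := fun g g' => ∑ x, η (y x) g * η x g' with hCdef
    have hC0 : ∀ g g', g ≠ g' → C g g' = 0 := by
      intro g g' hne
      have h := hcoef g g'
      rw [if_neg hne] at h
      rcases isEmpty_or_nonempty X with hX | ⟨⟨x₀⟩⟩
      · simp [hCdef]
      · have hunit : IsUnit (θ g) := by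
          refine IsUnit.of_mul_eq_one (η (y x₀) g * η x₀ g) ?_
          have := congrArg (algebraMap U V) (hyrel x₀ g)
          simp only [map_mul, map_one] at this
          rw [hθdef, hηdef]
          simp only
          linear_combination this
        exact (hunit.mul_right_eq_zero).mp h
    have hCdiag : ∀ g, C g g * (θ g * c) = ((Fintype.card X : ℕ) : V) * c := by
      intro g
      have h := hcoef g g
      rw [if_pos rfl] at h
      rw [← mul_assoc, mul_comm (C g g), h]
    calc ∑ x, P (y x) (F x m)
        = ∑ x, ∑ g, ∑ g', (η (y x) g * η x g') • gC g (fC g' m) := by simp only [hPF]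
      _ = ∑ g, ∑ g', ∑ x, (η (y x) g * η x g') • gC g (fC g' m) := by
          rw [Finset.sum_comm]
          exact Finset.sum_congr rfl fun g _ => Finset.sum_comm
      _ = ∑ g, ∑ g', C g g' • gC g (fC g' m) := by
          refine Finset.sum_congr rfl fun g _ => Finset.sum_congr rfl fun g' _ => ?_
          rw [← Finset.sum_smul]
      _ = ∑ g, C g g • gC g (fC g m) := by
          refine Finset.sum_congr rfl fun g _ => ?_
          exact Fintype.sum_eq_single g fun g' hne => by rw [hC0 g g' (Ne.symm hne), zero_smul]
      _ = ∑ g : G, (((Fintype.card X : ℕ) : V) * c) • m := by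
          refine Finset.sum_congr rfl fun g _ => ?_
          rw [hR3, smul_smul, hCdiag g]
      _ = (((Fintype.card G : ℕ) : V) * (((Fintype.card X : ℕ) : V) * c)) • m := by
          rw [Finset.sum_const, Finset.card_univ, ← Nat.cast_smul_eq_nsmul V, smul_smul]
  have hsum : ∀ m, ∑ q : ιX, Qf q (Pf q m) =
      (a * (((Fintype.card G : ℕ) : V) * (((Fintype.card X : ℕ) : V) * c))) • m := by
    intro m
    have hq : ∀ q : ιX, Qf q (Pf q m) = (b q.1 q.2 * b' q.1 q.2) • P (y q.1) (F q.1 m) := fun q => by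
      simp only [Pf, Qf, LinearMap.smul_apply, map_smul, smul_smul, mul_comm (b _ _)]
    simp only [hq]
    rw [show (∑ q : ιX, (b q.1 q.2 * b' q.1 q.2) • P (y q.1) (F q.1 m)) =
        ∑ x : X, ∑ k : Fin (nn x), (b x k * b' x k) • P (y x) (F x m) from
        Fintype.sum_sigma (fun q : ιX => (b q.1 q.2 * b' q.1 q.2) • P (y q.1) (F q.1 m))]
    simp only [← Finset.sum_smul, hab]
    rw [← Finset.smul_sum, hS m, smul_smul]
  -- restrict the equivariant family to the invariants and divide by `|G| |X| ∈ Uˣ`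
  have hu' : algebraMap U V (((Fintype.card G : ℕ) : U) * ((Fintype.card X : ℕ) : U) * u) =
      a * (((Fintype.card G : ℕ) : V) * (((Fintype.card X : ℕ) : V) * c)) := by
    rw [map_mul, map_mul, hu, map_natCast, map_natCast]
    ring
  obtain ⟨t, f', g', h⟩ := exists_comp_eq_smul_id_fixed_of_equivariant_family_group σ hfix hinj τ j hjinj hjτ
    hjsurj Pf Qf hPf hQf hsum _ hu'
  obtain ⟨wu, hwu⟩ := hGU.mul hXU
  refine ⟨t, (↑wu⁻¹ : U) • f', g', ?_⟩
  rw [LinearMap.comp_smul, h, smul_smul]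
  congr 1
  rw [← hwu, Units.inv_mul_cancel_left]

/-! ## CA-layer forms -/

/-- **Isotypic averaging for a finite group, CA-layer form**: `c` of character `ψ` stably annihilates the
`V`-module `M`, `a ∈ 𝔞_ψ^G` (given by decompositions as in `exists_comp_eq_smul_id_fixed_of_isotypic_group`),
`algebraMap U V u = a * c` ⟹ `u` stably annihilates the invariant `U`-module `N ≅ M^G`. [folklore] -/
theorem StablyAnnihilates.fixed_of_isotypic_group [Fintype G] (σ : G →* (V →ₐ[U] V))
    (hfix : ∀ v : V, (∀ g, σ g v = v) → ∃ u : U, algebraMap U V u = v)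
    (hinj : Function.Injective (algebraMap U V)) {X : Type*} [Fintype X] (χ : X → G → U)
    (hχone : ∀ x, χ x 1 = 1) (hχmul : ∀ x g h, χ x (g * h) = χ x g * χ x h)
    (horth : ∀ g : G, g ≠ 1 → ∑ x, χ x g = 0) (hXU : IsUnit ((Fintype.card X : ℕ) : U))
    (hGU : IsUnit ((Fintype.card G : ℕ) : U)) (τ : G → (M →+ M))
    (hτ : ∀ g (v : V) (m : M), τ g (v • m) = σ g v • τ g m) (hτmul : ∀ g h m, τ (g * h) m = τ g (τ h m))
    (hτone : ∀ m, τ 1 m = m) (j : N →ₗ[U] M) (hjinj : Function.Injective j) (hjτ : ∀ g n, τ g (j n) = j n)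
    (hjsurj : ∀ m, (∀ g, τ g m = m) → ∃ n, j n = m) {c : V} (ψ : G → U)
    (hc : ∀ g, σ g c = algebraMap U V (ψ g) * c) {a : V}
    (ha : ∀ x : X, ∃ (n : ℕ) (b b' : Fin n → V) (y : X), (∀ k g, σ g (b k) = algebraMap U V (χ x g) * b k) ∧
      (∀ k g, σ g (b' k) = algebraMap U V (χ y g) * b' k) ∧ (∀ g, χ y g * χ x g * ψ g = 1) ∧
      ∑ k, b k * b' k = a)
    (h : StablyAnnihilates V c (ModuleCat.of V M)) (u : U) (hu : algebraMap U V u = a * c) :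
    StablyAnnihilates U u (ModuleCat.of U N) := by
  obtain ⟨s, ι, π, hπι⟩ := (stablyAnnihilates_iff_exists_linearMap c (ModuleCat.of V M)).mp h
  obtain ⟨t, f', g', h'⟩ := exists_comp_eq_smul_id_fixed_of_isotypic_group σ hfix hinj χ hχone hχmul horth hXU
    hGU τ hτ hτmul hτone j hjinj hjτ hjsurj ψ hc ha ι π hπι u hu
  exact stablyAnnihilates_of_linearMap f' g' h'

end Summit.ResolutionOfSingularities.ResolutionOfSingularities.Theorems.HomologicalConductor.PersistenceCyclicTransferAbelian

end
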